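/-
Copyright (c) 2026. All rights reserved.
Released under Apache 2.0 license as described in the file LICENSE.
-/
import Literature.NumberTheory.ComplexMultiplication.DegenerateCMTypesCyclicPrimePowerExistence
import Literature.AlgebraicGeometry.Pohlmann1968.DegenerateCMTypesCyclicCMFieldPrimePower
import HarnessLib

/-!
# Simple abelian `p^k`-folds with complex multiplication by a CM field with Galois group `⟨ρ⟩ × ℤ_{p^k}`:
# every primitive rank of `DegenerateCMTypesCyclicPrimePowerExistence` is realised, with its exceptional classes;
# `ℚ(ζ₈₁)`: simple `27`-folds of each rank `28, 26, 22, 20`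

Number-field ∕ abelian-variety dress of `NumberTheory/ComplexMultiplication/DegenerateCMTypesCyclicPrimePowerExistence`
(explicit primitive types of `⟨ρ⟩ × ℤ_{p^k}` at each level), through the dictionary of
`Pohlmann1968/DegenerateCMTypesCyclicCMFieldPrimePower` (ranks, primitivity, the exceptional class of each level)
and Shimura's existence theorem (tree `exists_isCMTypeRealisation`).  B. Dodson [Dodson1987], Remark 4.5: "As a
corollary of the above analysis of Hol(`R₀`)-orbits, and of the existence of solvable CM-fields, we obtain the
existence of simple Abelian varieties of dimension `n = 18, 27, 36, 54`, and `72` with rank `10`" — here, for the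
CYCLIC groups `ℤ_{p^k}` and every odd `p`: simple abelian `p^k`-folds of each rank `p^k + 1`, `φ(p^k) + 2`,
`p^k + 1 − φ(p^j)` (`1 ≤ j ≤ k − 1`) over every CM field with Galois group `⟨ρ⟩ × ℤ_{p^k}` (e.g. cyclic of order
`2p^k`: `ℚ(ζ₈₁)`), the degenerate ones with their rational `(p^{k−j}, p^{k−j})`-classes outside `D`.
THEOREMS ONLY (no definition, no named fact, no `sorry`).

## What is proved

* §1 `exists_cmType_of_group` (transfer), **`exists_isPrimitive_cmTypeRank_eq`** (each listed rank is the rank of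
  a primitive CM type of `K`, all of whose abelian varieties are simple `p^k`-folds),
  **`exists_isPrimitive_cmTypeRank_eq_min`** (rank `φ(p^k) + 2`, a rational `(p^{k−i−1},p^{k−i−1})`-class outside
  `D` for every `i ≤ k − 2`), **`exists_isPrimitive_cmTypeRank_eq_level`** (rank `p^k + 1 − φ(p^j)`, a
  `(p^{k−j}, p^{k−j})`-class), **`exists_realisation_cmTypeRank_eq`** (such simple abelian varieties exist).
* §2 coordinate-free for CYCLIC Galois groups of order `2p^k`: `exists_realisation_cmTypeRank_eq_of_isCyclic`,
  `exists_realisation_exceptional_of_isCyclic`.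
* §3 degree `54` ∕ `ℚ(ζ₈₁)`: **`exists_realisation_cmTypeRank_eq_fiftyFour`** (simple `27`-folds of each rank
  `28, 26, 22, 20`), `exists_realisation_exceptional_fiftyFour` (rank `20` with rational `(9,9)`- and
  `(3,3)`-classes outside `D`), **`exists_realisation_eightyOne`**.

HONEST SCOPE.  The Hodge conjecture for the degenerate simple `p^k`-folds is NOT asserted: the exceptional classes
are exhibited, not shown algebraic.

## References

* [Dodson1987] B. Dodson, J. Algebra 111 (1987) 49–73: Prop. 4.1, Prop. 4.4 (1), Remark 4.5, Thm. 3.2.1.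
* [Hazama2003CyclicCM] F. Hazama, J. Math. Sci. Univ. Tokyo 10 (2003): Rem. 4.10, §5.
* [Kubota1965] T. Kubota, Trans. AMS 118 (1965), §4 Lemma 2.
* [Gordon1999HodgeAVSurvey] B. B. Gordon, 9.2.2, 9.4.3.
* [Shimura1998] G. Shimura, §6.2 Thm. 3, §8.1, §8.2 Prop. 26.
* [Washington1997] L. Washington, Thm. 2.5.

## Provenance

Lane `lit-hodgefound` (Track 2, Layer A3/B), seat `lit-hodgefound-p10` generation 35, row g35-#12; neighbours
cited by name, nothing restated: `DegenerateCMTypesCyclicPrimePowerExistence` (`exists_primitive_typeRank_eq`,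
`_min`, `_level`), `DegenerateCMTypesCyclicCMFieldPrimePower` (`rho_not_mem_zpowers`, `card_gal_eq`, `dim_eq`,
`exists_exceptional_of_level`, `exists_orderOf_eq_pow`, `cm_normal_cyclic_finrank_eightyOne`),
`DegenerateCMTypesCyclicCMFieldTwoOddPrimes` (`exists_cmType_of_isCMTypeWith`, `isPrimitive_iff`).
-/

open scoped BigOperators NumberField IsMulCommutative Classical
open CategoryTheory NumberField

namespace Literature.AlgebraicGeometry.Pohlmann1968

namespace CyclicPrimePower

open Literature.NumberTheory.ComplexMultiplication
open Literature.NumberTheory.ComplexMultiplication.CyclicCMType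
open Literature.NumberTheory.ComplexMultiplication.CyclicCMType.PrimePow
open Literature.AlgebraicGeometry.Motives (AbelianVariety CMType)
open Literature.AlgebraicGeometry.HodgeTheory
open Literature.AlgebraicGeometry.VanGeemen1994 (hodgeClassSpan)
open Literature.AlgebraicGeometry.ComplexMultiplication (IsCMTypeRealisation isSimple_iff_isPrimitive
  isPrimitive_ringEquiv_complex_iff exists_isCMTypeRealisation)
open Literature.Barriers.HodgeConjecture (divisorClassesSpan)
open Literature.AlgebraicGeometry.Pohlmann1968.CyclicTwoOddPrimes (gal_comm isCMTypeWith_galType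
  cmTypeRank_eq_typeRank_galType mem_galType_iff exists_cmType_of_isCMTypeWith separating_of_forall_not_isStableUnder)

/-! ## §1 CM types of `K` with prescribed primitive rank -/

section Types

variable {K : Type} [Field K] [NumberField K] [IsCMField K] [Normal ℚ K] [IsMulCommutative (K ≃ₐ[ℚ] K)]
variable {p : ℕ} [hp : Fact p.Prime] {ρ σ : K ≃ₐ[ℚ] K} {φ₀ : K →+* ℂ}

omit [IsCMField K] hp in
/-- **Transfer from the Galois group**: a group-level CM type `S` for `ρ` is `{g : σ_g ∈ Φ}` for a CM type `Φ` of
`K` with the same rank and the same primitivity. [cite: Shimura1998, §8.1 and §8.2 Prop. 26] [cite: Kubota1965, §4 Lemma 2] -/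
theorem exists_cmType_of_group (hρ : ∀ x, φ₀ (ρ x) = starRingEnd ℂ (φ₀ x)) {ΦG : Finset (K ≃ₐ[ℚ] K)}
    (h : IsCMTypeWith ρ (ΦG : Set (K ≃ₐ[ℚ] K))) (hprim : ∀ u : K ≃ₐ[ℚ] K, u ≠ 1 → ¬ IsStableUnder ΦG u) :
    ∃ Φ : CMType K, (Finset.univ.filter fun g : K ≃ₐ[ℚ] K => embOf φ₀ g ∈ Φ.1) = ΦG ∧
      (∀ φh : K →+* ℂ, IsPrimitive (ℂ ≃+* ℂ) Φ.1 φh) ∧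
        cmTypeRank Φ = typeRank (K ≃ₐ[ℚ] K) (ΦG : Set (K ≃ₐ[ℚ] K)) := by
  obtain ⟨Φ, hΦ⟩ := exists_cmType_of_isCMTypeWith (φ₀ := φ₀) hρ h
  refine ⟨Φ, hΦ, fun φh => (CyclicTwoOddPrimes.isPrimitive_iff (φ₀ := φ₀) Φ φh).2 (by rw [hΦ]; exact hprim), ?_⟩
  rw [cmTypeRank_eq_typeRank_galType Φ φ₀, hΦ]

/-- **Every CM field with Galois group `⟨ρ⟩ × ℤ_{p^k}` has PRIMITIVE CM types of each of the ranks `p^k + 1`,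
`φ(p^k) + 2` and `p^k + 1 − φ(p^j)` (`1 ≤ j ≤ k − 1`)**, all of whose abelian varieties are simple `p^k`-folds.
[cite: Dodson1987, Prop. 4.1, Prop. 4.4 (1) and Remark 4.5] [cite: Kubota1965, §4 Lemma 2] -/
theorem exists_isPrimitive_cmTypeRank_eq (hp2 : p ≠ 2) (hρ : ∀ x, φ₀ (ρ x) = starRingEnd ℂ (φ₀ x)) {m : ℕ}
    (hσ : orderOf σ = p ^ (m + 1)) (hK : Module.finrank ℚ K = 2 * p ^ (m + 1)) (r : ℕ)
    (hr : r = p ^ (m + 1) + 1 ∨ r = p ^ (m + 1) - p ^ m + 2 ∨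
      ∃ i₀ < m, r + (p ^ (i₀ + 1) - p ^ i₀) = p ^ (m + 1) + 1) :
    ∃ Φ : CMType K, (∀ φh : K →+* ℂ, IsPrimitive (ℂ ≃+* ℂ) Φ.1 φh) ∧ cmTypeRank Φ = r ∧
      ∀ (A : AbelianVariety ℂ) (ι : 𝓞 K →+* End A) (θ : K →+* Module.End ℂ (complexBetti A.X 1)),
        IsCMTypeRealisation Φ A ι θ → A.IsSimple ∧ A.dim = p ^ (m + 1) := by
  obtain ⟨ΦG, h, hprim, hrank⟩ := exists_primitive_typeRank_eq hp2 hσ (rho_not_mem_zpowers hp2 hρ hσ)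
    (card_gal_eq φ₀ hK) (conjGalElt_mul_self hρ) r hr
  obtain ⟨Φ, -, hprimΦ, hrk⟩ := exists_cmType_of_group hρ h hprim
  exact ⟨Φ, hprimΦ, by rw [hrk, hrank], fun A ι θ hA =>
    ⟨(isSimple_iff_isPrimitive hA φ₀).2 (hprimΦ φ₀), dim_eq hK hA⟩⟩

/-- **THE MINIMAL RANK `φ(p^k) + 2` WITH ALL ITS EXCEPTIONAL CLASSES.**  Every CM field with Galois group
`⟨ρ⟩ × ℤ_{p^k}` has a primitive CM type of rank `p^k − p^{k−1} + 2`, equidistributed at every level `< k`, so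
that every abelian variety of this type is a simple `p^k`-fold carrying, for EACH `0 ≤ i ≤ k − 2`, a rational
`(p^{k−i−1}, p^{k−i−1})`-class outside `D^{p^{k−i−1}} ⊗ ℂ` (codimensions `p^{k−1}, …, p`).
[cite: Dodson1987, Prop. 4.4 (1) and Remark 4.5] [cite: Hazama2003CyclicCM, Rem. 4.10 and §5]
[cite: Gordon1999HodgeAVSurvey, 9.2.2] -/
theorem exists_isPrimitive_cmTypeRank_eq_min (hp2 : p ≠ 2) (hρ : ∀ x, φ₀ (ρ x) = starRingEnd ℂ (φ₀ x))
    {m : ℕ} (hσ : orderOf σ = p ^ (m + 1)) (hK : Module.finrank ℚ K = 2 * p ^ (m + 1)) :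
    ∃ Φ : CMType K, (∀ φh : K →+* ℂ, IsPrimitive (ℂ ≃+* ℂ) Φ.1 φh) ∧
      cmTypeRank Φ = p ^ (m + 1) - p ^ m + 2 ∧
      ∀ (A : AbelianVariety ℂ) (ι : 𝓞 K →+* End A) (θ : K →+* Module.End ℂ (complexBetti A.X 1)),
        IsCMTypeRealisation Φ A ι θ → A.IsSimple ∧ A.dim = p ^ (m + 1) ∧
          ∀ i < m, ∃ c : complexBetti A.X (2 * p ^ (m + 1 - (i + 1))), IsRationalClass c ∧
            IsOfHodgeType (p ^ (m + 1)) A.X (2 * p ^ (m + 1 - (i + 1))) (p ^ (m + 1 - (i + 1)))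
              (p ^ (m + 1 - (i + 1))) c ∧
            c ∉ divisorClassesSpan A.X (p ^ (m + 1)) (p ^ (m + 1 - (i + 1))) := by
  have hρσ := rho_not_mem_zpowers hp2 hρ hσ
  obtain ⟨ΦG, h, hprim, hL, hrank⟩ := exists_primitive_typeRank_eq_min hp2 hσ hρσ (card_gal_eq φ₀ hK)
    (conjGalElt_mul_self hρ)
  obtain ⟨Φ, hΦ, hprimΦ, hrk⟩ := exists_cmType_of_group hρ h hprim
  refine ⟨Φ, hprimΦ, by rw [hrk, hrank], fun A ι θ hA =>
    ⟨(isSimple_iff_isPrimitive hA φ₀).2 (hprimΦ φ₀), dim_eq hK hA, fun i hi => ?_⟩⟩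
  have hprim' : ∀ u : K ≃ₐ[ℚ] K, u ≠ 1 →
      ¬ IsStableUnder (Finset.univ.filter fun g : K ≃ₐ[ℚ] K => embOf φ₀ g ∈ Φ.1) u := by rw [hΦ]; exact hprim
  refine exists_exceptional_of_level hp2 hρ hσ hK hprim' (Nat.lt_succ_of_lt hi) ?_ hA
  rw [hΦ]
  exact hL i hi

/-- **ONE LEVEL AT A TIME.**  For each `1 ≤ j = i₀ + 1 ≤ k − 1`, every CM field with Galois group `⟨ρ⟩ × ℤ_{p^k}`
has a primitive CM type of rank `p^k + 1 − φ(p^j)` (equidistributed at the level `j` only), all of whose abelian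
varieties are simple `p^k`-folds with a rational `(p^{k−j}, p^{k−j})`-class outside `D^{p^{k−j}} ⊗ ℂ`.
[cite: Dodson1987, Prop. 4.4 (1), Remark 4.5 and Thm. 3.2.1] [cite: Hazama2003CyclicCM, Rem. 4.10 and §5]
[cite: Gordon1999HodgeAVSurvey, 9.2.2] -/
theorem exists_isPrimitive_cmTypeRank_eq_level (hp2 : p ≠ 2) (hρ : ∀ x, φ₀ (ρ x) = starRingEnd ℂ (φ₀ x))
    {m : ℕ} (hσ : orderOf σ = p ^ (m + 1)) (hK : Module.finrank ℚ K = 2 * p ^ (m + 1)) {i₀ : ℕ} (hi₀ : i₀ < m) :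
    ∃ Φ : CMType K, (∀ φh : K →+* ℂ, IsPrimitive (ℂ ≃+* ℂ) Φ.1 φh) ∧
      cmTypeRank Φ + (p ^ (i₀ + 1) - p ^ i₀) = p ^ (m + 1) + 1 ∧
      ∀ (A : AbelianVariety ℂ) (ι : 𝓞 K →+* End A) (θ : K →+* Module.End ℂ (complexBetti A.X 1)),
        IsCMTypeRealisation Φ A ι θ → A.IsSimple ∧ A.dim = p ^ (m + 1) ∧
          ∃ c : complexBetti A.X (2 * p ^ (m + 1 - (i₀ + 1))), IsRationalClass c ∧
            IsOfHodgeType (p ^ (m + 1)) A.X (2 * p ^ (m + 1 - (i₀ + 1))) (p ^ (m + 1 - (i₀ + 1)))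
              (p ^ (m + 1 - (i₀ + 1))) c ∧
            c ∉ divisorClassesSpan A.X (p ^ (m + 1)) (p ^ (m + 1 - (i₀ + 1))) := by
  have hρσ := rho_not_mem_zpowers hp2 hρ hσ
  obtain ⟨ΦG, h, hprim, hL, hrank⟩ := exists_primitive_typeRank_eq_level hp2 hσ hρσ (card_gal_eq φ₀ hK)
    (conjGalElt_mul_self hρ) hi₀
  obtain ⟨Φ, hΦ, hprimΦ, hrk⟩ := exists_cmType_of_group hρ h hprim
  refine ⟨Φ, hprimΦ, by rw [hrk, hrank], fun A ι θ hA =>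
    ⟨(isSimple_iff_isPrimitive hA φ₀).2 (hprimΦ φ₀), dim_eq hK hA, ?_⟩⟩
  have hprim' : ∀ u : K ≃ₐ[ℚ] K, u ≠ 1 →
      ¬ IsStableUnder (Finset.univ.filter fun g : K ≃ₐ[ℚ] K => embOf φ₀ g ∈ Φ.1) u := by rw [hΦ]; exact hprim
  refine exists_exceptional_of_level hp2 hρ hσ hK hprim' (Nat.lt_succ_of_lt hi₀) ?_ hA
  rw [hΦ]
  exact (hL i₀ hi₀).2 rfl

/-- **Simple abelian `p^k`-folds of each of these ranks EXIST over `K`** (Shimura's existence theorem).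
[cite: Dodson1987, Remark 4.5] [cite: Shimura1998, §6.2 Theorem 3] -/
theorem exists_realisation_cmTypeRank_eq (hp2 : p ≠ 2) (hρ : ∀ x, φ₀ (ρ x) = starRingEnd ℂ (φ₀ x)) {m : ℕ}
    (hσ : orderOf σ = p ^ (m + 1)) (hK : Module.finrank ℚ K = 2 * p ^ (m + 1)) (r : ℕ)
    (hr : r = p ^ (m + 1) + 1 ∨ r = p ^ (m + 1) - p ^ m + 2 ∨
      ∃ i₀ < m, r + (p ^ (i₀ + 1) - p ^ i₀) = p ^ (m + 1) + 1) :
    ∃ (Φ : CMType K) (A : AbelianVariety ℂ) (ι : 𝓞 K →+* End A) (θ : K →+* Module.End ℂ (complexBetti A.X 1)),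
      IsCMTypeRealisation Φ A ι θ ∧ A.IsSimple ∧ A.dim = p ^ (m + 1) ∧ cmTypeRank Φ = r := by
  obtain ⟨Φ, -, hrank, hall⟩ := exists_isPrimitive_cmTypeRank_eq hp2 hρ hσ hK r hr
  obtain ⟨A, ι, θ, hA⟩ := exists_isCMTypeRealisation Φ
  exact ⟨Φ, A, ι, θ, hA, (hall A ι θ hA).1, (hall A ι θ hA).2, hrank⟩

end Types

/-! ## §2 CM fields with CYCLIC Galois group of order `2p^k`: coordinate-free existence -/

section Cyclic

open Literature.AlgebraicGeometry.ComplexMultiplication.CyclicTwoPower (exists_conj_gal)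

variable {K : Type} [Field K] [NumberField K] [IsCMField K] [Normal ℚ K] {p : ℕ}

omit [IsCMField K] [Normal ℚ K] in
/-- A cyclic Galois group is commutative. [folklore] -/
private theorem comm_of_isCyclic (hcyc : IsCyclic (K ≃ₐ[ℚ] K)) : ∀ g h : K ≃ₐ[ℚ] K, g * h = h * g := by
  obtain ⟨γ, hγ⟩ := hcyc.exists_generator
  intro g h
  obtain ⟨a, rfl⟩ := Subgroup.mem_zpowers_iff.1 (hγ g)
  obtain ⟨b, rfl⟩ := Subgroup.mem_zpowers_iff.1 (hγ h)
  rw [← zpow_add, ← zpow_add, add_comm]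

/-- **Every CM field with cyclic Galois group of order `2p^k` (`p` odd, `k = m + 1 ≥ 1`) is the CM field of SIMPLE
abelian `p^k`-folds of each of the ranks `p^k + 1`, `φ(p^k) + 2`, `p^k + 1 − φ(p^j)` (`1 ≤ j ≤ k − 1`)** —
Remark 4.5's method ("the existence of solvable CM-fields") for the cyclic groups. [cite: Dodson1987, Remark 4.5]
[cite: Shimura1998, §6.2 Theorem 3] -/
theorem exists_realisation_cmTypeRank_eq_of_isCyclic (hcyc : IsCyclic (K ≃ₐ[ℚ] K)) (hp : p.Prime) (hp2 : p ≠ 2)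
    {m : ℕ} (hK : Module.finrank ℚ K = 2 * p ^ (m + 1)) (r : ℕ)
    (hr : r = p ^ (m + 1) + 1 ∨ r = p ^ (m + 1) - p ^ m + 2 ∨
      ∃ i₀ < m, r + (p ^ (i₀ + 1) - p ^ i₀) = p ^ (m + 1) + 1) :
    ∃ (Φ : CMType K) (A : AbelianVariety ℂ) (ι : 𝓞 K →+* End A) (θ : K →+* Module.End ℂ (complexBetti A.X 1)),
      IsCMTypeRealisation Φ A ι θ ∧ A.IsSimple ∧ A.dim = p ^ (m + 1) ∧ cmTypeRank Φ = r := by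
  haveI : Fact p.Prime := ⟨hp⟩
  haveI : IsMulCommutative (K ≃ₐ[ℚ] K) := ⟨⟨comm_of_isCyclic hcyc⟩⟩
  obtain ⟨φ₀⟩ := (inferInstance : Nonempty (K →+* ℂ))
  obtain ⟨ρ, hρall⟩ := exists_conj_gal (K := K)
  obtain ⟨σ, hσ⟩ := exists_orderOf_eq_pow hcyc φ₀ hK
  exact exists_realisation_cmTypeRank_eq hp2 (hρall φ₀) hσ hK r hr

/-- **… and of simple abelian `p^k`-folds of the minimal primitive rank `φ(p^k) + 2` carrying rational
`(p^{k−i−1}, p^{k−i−1})`-classes outside `D` for every `i ≤ k − 2`.** [cite: Dodson1987, Remark 4.5]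
[cite: Hazama2003CyclicCM, Rem. 4.10] [cite: Gordon1999HodgeAVSurvey, 9.2.2] -/
theorem exists_realisation_exceptional_of_isCyclic (hcyc : IsCyclic (K ≃ₐ[ℚ] K)) (hp : p.Prime) (hp2 : p ≠ 2)
    {m : ℕ} (hK : Module.finrank ℚ K = 2 * p ^ (m + 1)) :
    ∃ (Φ : CMType K) (A : AbelianVariety ℂ) (ι : 𝓞 K →+* End A) (θ : K →+* Module.End ℂ (complexBetti A.X 1)),
      IsCMTypeRealisation Φ A ι θ ∧ A.IsSimple ∧ A.dim = p ^ (m + 1) ∧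
        cmTypeRank Φ = p ^ (m + 1) - p ^ m + 2 ∧
        ∀ i < m, ∃ c : complexBetti A.X (2 * p ^ (m + 1 - (i + 1))), IsRationalClass c ∧
          IsOfHodgeType (p ^ (m + 1)) A.X (2 * p ^ (m + 1 - (i + 1))) (p ^ (m + 1 - (i + 1)))
            (p ^ (m + 1 - (i + 1))) c ∧
          c ∉ divisorClassesSpan A.X (p ^ (m + 1)) (p ^ (m + 1 - (i + 1))) := by
  haveI : Fact p.Prime := ⟨hp⟩
  haveI : IsMulCommutative (K ≃ₐ[ℚ] K) := ⟨⟨comm_of_isCyclic hcyc⟩⟩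
  obtain ⟨φ₀⟩ := (inferInstance : Nonempty (K →+* ℂ))
  obtain ⟨ρ, hρall⟩ := exists_conj_gal (K := K)
  obtain ⟨σ, hσ⟩ := exists_orderOf_eq_pow hcyc φ₀ hK
  obtain ⟨Φ, -, hrank, hall⟩ := exists_isPrimitive_cmTypeRank_eq_min hp2 (hρall φ₀) hσ hK
  obtain ⟨A, ι, θ, hA⟩ := exists_isCMTypeRealisation Φ
  obtain ⟨hs, hd, hex⟩ := hall A ι θ hA
  exact ⟨Φ, A, ι, θ, hA, hs, hd, hrank, hex⟩

end Cyclic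

/-! ## §3 Degree `54` and `ℚ(ζ₈₁)`: simple `27`-folds of each rank `28, 26, 22, 20` -/

section TwentySeven

open Literature.AlgebraicGeometry.ComplexMultiplication.CyclicTwoPower (exists_conj_gal)

variable {K : Type} [Field K] [NumberField K] [IsCMField K] [Normal ℚ K]

/-- **Every CM field with cyclic Galois group of order `54` is the CM field of simple abelian `27`-folds of each
rank `28, 26, 22, 20`** (and of no other rank: `cmTypeRank_mem_of_isCyclic_fiftyFour`).
[cite: Dodson1987, Prop. 4.4 (1) and Remark 4.5] [cite: Shimura1998, §6.2 Theorem 3] -/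
theorem exists_realisation_cmTypeRank_eq_fiftyFour (hcyc : IsCyclic (K ≃ₐ[ℚ] K)) (hK : Module.finrank ℚ K = 54)
    {r : ℕ} (hr : r ∈ ({28, 26, 22, 20} : Finset ℕ)) :
    ∃ (Φ : CMType K) (A : AbelianVariety ℂ) (ι : 𝓞 K →+* End A) (θ : K →+* Module.End ℂ (complexBetti A.X 1)),
      IsCMTypeRealisation Φ A ι θ ∧ A.IsSimple ∧ A.dim = 27 ∧ cmTypeRank Φ = r := by
  have hK' : Module.finrank ℚ K = 2 * 3 ^ (2 + 1) := by rw [hK]; norm_num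
  have key := exists_realisation_cmTypeRank_eq_of_isCyclic hcyc Nat.prime_three (by norm_num) hK' r ?_
  · simpa using key
  simp only [Finset.mem_insert, Finset.mem_singleton] at hr
  rcases hr with rfl | rfl | rfl | rfl
  · left; norm_num
  · right; right; exact ⟨0, by norm_num, by norm_num⟩
  · right; right; exact ⟨1, by norm_num, by norm_num⟩
  · right; left; norm_num

/-- **… a simple `27`-fold of rank `20` with a rational `(9,9)`-class outside `D⁹ ⊗ ℂ` AND a rational `(3,3)`-class
outside `D³ ⊗ ℂ`.** [cite: Dodson1987, Remark 4.5] [cite: Hazama2003CyclicCM, Rem. 4.10] [cite: Gordon1999HodgeAVSurvey, 9.2.2] -/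
theorem exists_realisation_exceptional_fiftyFour (hcyc : IsCyclic (K ≃ₐ[ℚ] K)) (hK : Module.finrank ℚ K = 54) :
    ∃ (Φ : CMType K) (A : AbelianVariety ℂ) (ι : 𝓞 K →+* End A) (θ : K →+* Module.End ℂ (complexBetti A.X 1)),
      IsCMTypeRealisation Φ A ι θ ∧ A.IsSimple ∧ A.dim = 27 ∧ cmTypeRank Φ = 20 ∧
        (∃ c : complexBetti A.X 18, IsRationalClass c ∧ IsOfHodgeType 27 A.X 18 9 9 c ∧
          c ∉ divisorClassesSpan A.X 27 9) ∧
        ∃ c : complexBetti A.X 6, IsRationalClass c ∧ IsOfHodgeType 27 A.X 6 3 3 c ∧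
          c ∉ divisorClassesSpan A.X 27 3 := by
  have hK' : Module.finrank ℚ K = 2 * 3 ^ (2 + 1) := by rw [hK]; norm_num
  obtain ⟨Φ, A, ι, θ, hA, hs, hd, hrank, hex⟩ :=
    exists_realisation_exceptional_of_isCyclic hcyc Nat.prime_three (by norm_num) hK'
  obtain ⟨c₉, hc₉⟩ := hex 0 (by norm_num)
  obtain ⟨c₃, hc₃⟩ := hex 1 (by norm_num)
  refine ⟨Φ, A, ι, θ, hA, hs, by rw [hd]; norm_num, by rw [hrank]; norm_num, ⟨c₉, hc₉⟩, ⟨c₃, hc₃⟩⟩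

/-- **`ℚ(ζ₈₁)` is the CM field of simple abelian `27`-folds of each rank `28, 26, 22, 20`**, and of one of rank
`20` with rational `(9,9)`- and `(3,3)`-classes outside the divisor classes. [cite: Dodson1987, Prop. 4.4 (1) and Remark 4.5]
[cite: Hazama2003CyclicCM, Rem. 4.10] [cite: Washington1997, Thm. 2.5] -/
theorem exists_realisation_eightyOne (L : Type) [Field L] [NumberField L] [IsCyclotomicExtension {81} ℚ L] :
    (∀ r ∈ ({28, 26, 22, 20} : Finset ℕ),
      ∃ (Φ : CMType L) (A : AbelianVariety ℂ) (ι : 𝓞 L →+* End A) (θ : L →+* Module.End ℂ (complexBetti A.X 1)),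
        IsCMTypeRealisation Φ A ι θ ∧ A.IsSimple ∧ A.dim = 27 ∧ cmTypeRank Φ = r) ∧
    ∃ (Φ : CMType L) (A : AbelianVariety ℂ) (ι : 𝓞 L →+* End A) (θ : L →+* Module.End ℂ (complexBetti A.X 1)),
      IsCMTypeRealisation Φ A ι θ ∧ A.IsSimple ∧ A.dim = 27 ∧ cmTypeRank Φ = 20 ∧
        (∃ c : complexBetti A.X 18, IsRationalClass c ∧ IsOfHodgeType 27 A.X 18 9 9 c ∧
          c ∉ divisorClassesSpan A.X 27 9) ∧
        ∃ c : complexBetti A.X 6, IsRationalClass c ∧ IsOfHodgeType 27 A.X 6 3 3 c ∧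
          c ∉ divisorClassesSpan A.X 27 3 := by
  obtain ⟨hcm, hno, hcyc, hK⟩ := cm_normal_cyclic_finrank_eightyOne L
  haveI := hcm
  haveI := hno
  exact ⟨fun r hr => exists_realisation_cmTypeRank_eq_fiftyFour hcyc hK hr,
    exists_realisation_exceptional_fiftyFour hcyc hK⟩

end TwentySeven

end CyclicPrimePower

end Literature.AlgebraicGeometry.Pohlmann1968
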